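import Mathlib
import Summits.KontsevichZagierPeriods.Zeta5Search.ResidueIdentityProof
import HarnessLib

/-!
# ζ(5) search — logarithmic Taylor coefficients of finite products of power series (orders ≤ 3) and finite-field power sums

HONEST FRAMING: systematic search; no irrationality claim unless certified.

Cell `pub-zeta5`, gen-2 seat generation 15 (REPORT-gen2-g15 §6), for the RESIDUE SIDE of the second residue law L5
(`SecondOrder.liveKappaSum_small`, next files; item (K)(D)(∞) of REPORT-gen2-g14 §3/§6).  PURE ALGEBRA over an arbitrary field `K`
with `2 ≠ 0`, `3 ≠ 0` (no statement about ζ(5)):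
* §1 the first three LOGARITHMIC COEFFICIENTS `λ₁ = c₁/c₀`, `λ₂ = c₂/c₀ − λ₁²/2`, `λ₃ = c₃/c₀ − λ₁c₂/c₀ + λ₁³/3` of a power series with
  `c₀ ≠ 0` (the coefficients of `log(F/c₀)`): ADDITIVE under products (`lam*_mul`, `lam*_prod`, `lam*_pow`), odd under inversion
  (`lam*_inv`), blind to constants, and explicit on a linear factor `d + X` (`λ₁ = d⁻¹`, `λ₂ = −d⁻²/2`, `λ₃ = d⁻³/3`); the Taylor
  coefficients are recovered as `c₁ = c₀λ₁`, `c₂ = c₀(λ₂ + λ₁²/2)`, `c₃ = c₀(λ₃ + λ₁λ₂ + λ₁³/6)`;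
* §2 in `ZMod p`: `Σ_{y<p, y≠x} ((y − x)⁻¹)^m = 0` for `1 ≤ m`, `m + 1 < p` (`= Σ_{z∈F_p} z^m`).
-/

open Finset

namespace Summit.KontsevichZagierPeriods.Zeta5Search.ResidueFour

section LogCoeff

open PowerSeries

variable {K : Type*} [Field K]

/-- Low coefficients of a product: order `1`. -/
theorem coeff_one_mul_eq (F G : PowerSeries K) : coeff 1 (F * G) = coeff 0 F * coeff 1 G + coeff 1 F * coeff 0 G := by
  rw [coeff_mul, Nat.sum_antidiagonal_eq_sum_range_succ_mk, sum_range_succ, sum_range_succ, sum_range_zero]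
  simp

/-- Low coefficients of a product: order `2`. -/
theorem coeff_two_mul_eq (F G : PowerSeries K) :
    coeff 2 (F * G) = coeff 0 F * coeff 2 G + coeff 1 F * coeff 1 G + coeff 2 F * coeff 0 G := by
  rw [coeff_mul, Nat.sum_antidiagonal_eq_sum_range_succ_mk, sum_range_succ, sum_range_succ, sum_range_succ, sum_range_zero]
  simp

/-- Low coefficients of a product: order `3`. -/
theorem coeff_three_mul_eq (F G : PowerSeries K) :
    coeff 3 (F * G) = coeff 0 F * coeff 3 G + coeff 1 F * coeff 2 G + coeff 2 F * coeff 1 G + coeff 3 F * coeff 0 G := by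
  rw [coeff_mul, Nat.sum_antidiagonal_eq_sum_range_succ_mk, sum_range_succ, sum_range_succ, sum_range_succ, sum_range_succ,
    sum_range_zero]
  simp

/-- `λ₁(F) = c₁/c₀`. -/
noncomputable def lam1 (F : PowerSeries K) : K := coeff 1 F / coeff 0 F

/-- `λ₂(F) = c₂/c₀ − λ₁²/2`. -/
noncomputable def lam2 (F : PowerSeries K) : K := coeff 2 F / coeff 0 F - (coeff 1 F / coeff 0 F) ^ 2 / 2

/-- `λ₃(F) = c₃/c₀ − λ₁·c₂/c₀ + λ₁³/3`. -/
noncomputable def lam3 (F : PowerSeries K) : K :=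
  coeff 3 F / coeff 0 F - (coeff 1 F / coeff 0 F) * (coeff 2 F / coeff 0 F) + (coeff 1 F / coeff 0 F) ^ 3 / 3

/-- The constant coefficient of a product. -/
theorem coeff_zero_mul_eq (F G : PowerSeries K) : coeff 0 (F * G) = coeff 0 F * coeff 0 G := by
  rw [coeff_zero_eq_constantCoeff_apply, map_mul, coeff_zero_eq_constantCoeff_apply, coeff_zero_eq_constantCoeff_apply]

/-- `lam1_mul` (auxiliary lemma). -/
theorem lam1_mul {F G : PowerSeries K} (hF : coeff 0 F ≠ 0) (hG : coeff 0 G ≠ 0) : lam1 (F * G) = lam1 F + lam1 G := by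
  unfold lam1
  rw [coeff_one_mul_eq, coeff_zero_mul_eq]
  field_simp
  ring

/-- `lam2_mul` (auxiliary lemma). -/
theorem lam2_mul {F G : PowerSeries K} (hF : coeff 0 F ≠ 0) (hG : coeff 0 G ≠ 0) (h2 : (2 : K) ≠ 0) :
    lam2 (F * G) = lam2 F + lam2 G := by
  unfold lam2
  rw [coeff_two_mul_eq, coeff_one_mul_eq, coeff_zero_mul_eq]
  field_simp
  ring

/-- `lam3_mul` (auxiliary lemma). -/
theorem lam3_mul {F G : PowerSeries K} (hF : coeff 0 F ≠ 0) (hG : coeff 0 G ≠ 0) (h3 : (3 : K) ≠ 0) :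
    lam3 (F * G) = lam3 F + lam3 G := by
  unfold lam3
  rw [coeff_three_mul_eq, coeff_two_mul_eq, coeff_one_mul_eq, coeff_zero_mul_eq]
  field_simp
  ring

/-- `lam1_one` (auxiliary lemma). -/
theorem lam1_one : lam1 (1 : PowerSeries K) = 0 := by simp [lam1, coeff_one]

/-- `lam2_one` (auxiliary lemma). -/
theorem lam2_one : lam2 (1 : PowerSeries K) = 0 := by simp [lam2, coeff_one]

/-- `lam3_one` (auxiliary lemma). -/
theorem lam3_one : lam3 (1 : PowerSeries K) = 0 := by simp [lam3, coeff_one]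

/-- `lam1_C` (auxiliary lemma). -/
theorem lam1_C (a : K) : lam1 (C a) = 0 := by simp [lam1, coeff_C]

/-- `lam2_C` (auxiliary lemma). -/
theorem lam2_C (a : K) : lam2 (C a) = 0 := by simp [lam2, coeff_C]

/-- `lam3_C` (auxiliary lemma). -/
theorem lam3_C (a : K) : lam3 (C a) = 0 := by simp [lam3, coeff_C]

/-- The constant coefficient of a finite product. -/
theorem coeff_zero_prod_eq {ι : Type*} (s : Finset ι) (F : ι → PowerSeries K) :
    coeff 0 (∏ i ∈ s, F i) = ∏ i ∈ s, coeff 0 (F i) := by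
  simp only [coeff_zero_eq_constantCoeff_apply, map_prod]

/-- The constant coefficient of a power. -/
theorem coeff_zero_pow_eq (F : PowerSeries K) (n : ℕ) : coeff 0 (F ^ n) = coeff 0 F ^ n := by
  simp only [coeff_zero_eq_constantCoeff_apply, map_pow]

/-- `lam1_prod` (auxiliary lemma). -/
theorem lam1_prod {ι : Type*} (s : Finset ι) (F : ι → PowerSeries K) (h0 : ∀ i ∈ s, coeff 0 (F i) ≠ 0) :
    lam1 (∏ i ∈ s, F i) = ∑ i ∈ s, lam1 (F i) := by
  classical
  induction s using Finset.induction_on with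
  | empty => simp [lam1_one]
  | insert a s ha ih =>
    rw [prod_insert ha, sum_insert ha, lam1_mul (h0 a (mem_insert_self a s))
      (by rw [coeff_zero_prod_eq]; exact prod_ne_zero_iff.2 fun i hi => h0 i (mem_insert_of_mem hi)),
      ih fun i hi => h0 i (mem_insert_of_mem hi)]

/-- `lam2_prod` (auxiliary lemma). -/
theorem lam2_prod {ι : Type*} (s : Finset ι) (F : ι → PowerSeries K) (h0 : ∀ i ∈ s, coeff 0 (F i) ≠ 0) (h2 : (2 : K) ≠ 0) :
    lam2 (∏ i ∈ s, F i) = ∑ i ∈ s, lam2 (F i) := by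
  classical
  induction s using Finset.induction_on with
  | empty => simp [lam2_one]
  | insert a s ha ih =>
    rw [prod_insert ha, sum_insert ha, lam2_mul (h0 a (mem_insert_self a s))
      (by rw [coeff_zero_prod_eq]; exact prod_ne_zero_iff.2 fun i hi => h0 i (mem_insert_of_mem hi)) h2,
      ih fun i hi => h0 i (mem_insert_of_mem hi)]

/-- `lam3_prod` (auxiliary lemma). -/
theorem lam3_prod {ι : Type*} (s : Finset ι) (F : ι → PowerSeries K) (h0 : ∀ i ∈ s, coeff 0 (F i) ≠ 0) (h3 : (3 : K) ≠ 0) :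
    lam3 (∏ i ∈ s, F i) = ∑ i ∈ s, lam3 (F i) := by
  classical
  induction s using Finset.induction_on with
  | empty => simp [lam3_one]
  | insert a s ha ih =>
    rw [prod_insert ha, sum_insert ha, lam3_mul (h0 a (mem_insert_self a s))
      (by rw [coeff_zero_prod_eq]; exact prod_ne_zero_iff.2 fun i hi => h0 i (mem_insert_of_mem hi)) h3,
      ih fun i hi => h0 i (mem_insert_of_mem hi)]

/-- `lam1_pow` (auxiliary lemma). -/
theorem lam1_pow (F : PowerSeries K) (hF : coeff 0 F ≠ 0) (n : ℕ) : lam1 (F ^ n) = n * lam1 F := by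
  rw [Finset.pow_eq_prod_const, lam1_prod _ _ fun _ _ => hF, sum_const, card_range, nsmul_eq_mul]

/-- `lam2_pow` (auxiliary lemma). -/
theorem lam2_pow (F : PowerSeries K) (hF : coeff 0 F ≠ 0) (h2 : (2 : K) ≠ 0) (n : ℕ) : lam2 (F ^ n) = n * lam2 F := by
  rw [Finset.pow_eq_prod_const, lam2_prod _ _ (fun _ _ => hF) h2, sum_const, card_range, nsmul_eq_mul]

/-- `lam3_pow` (auxiliary lemma). -/
theorem lam3_pow (F : PowerSeries K) (hF : coeff 0 F ≠ 0) (h3 : (3 : K) ≠ 0) (n : ℕ) : lam3 (F ^ n) = n * lam3 F := by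
  rw [Finset.pow_eq_prod_const, lam3_prod _ _ (fun _ _ => hF) h3, sum_const, card_range, nsmul_eq_mul]

/-- The inverse has inverse constant coefficient. -/
theorem coeff_zero_inv_eq (F : PowerSeries K) : coeff 0 F⁻¹ = (coeff 0 F)⁻¹ := by
  rw [coeff_zero_eq_constantCoeff_apply, constantCoeff_inv, coeff_zero_eq_constantCoeff_apply]

/-- `lam1_inv` (auxiliary lemma). -/
theorem lam1_inv (F : PowerSeries K) (hF : coeff 0 F ≠ 0) : lam1 F⁻¹ = -lam1 F := by
  have hi : coeff 0 F⁻¹ ≠ 0 := by rw [coeff_zero_inv_eq]; exact inv_ne_zero hF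
  have h := lam1_mul hF hi
  rw [PowerSeries.mul_inv_cancel F (by rwa [coeff_zero_eq_constantCoeff_apply] at hF), lam1_one] at h
  linear_combination -h

/-- `lam2_inv` (auxiliary lemma). -/
theorem lam2_inv (F : PowerSeries K) (hF : coeff 0 F ≠ 0) (h2 : (2 : K) ≠ 0) : lam2 F⁻¹ = -lam2 F := by
  have hi : coeff 0 F⁻¹ ≠ 0 := by rw [coeff_zero_inv_eq]; exact inv_ne_zero hF
  have h := lam2_mul hF hi h2
  rw [PowerSeries.mul_inv_cancel F (by rwa [coeff_zero_eq_constantCoeff_apply] at hF), lam2_one] at h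
  linear_combination -h

/-- `lam3_inv` (auxiliary lemma). -/
theorem lam3_inv (F : PowerSeries K) (hF : coeff 0 F ≠ 0) (h3 : (3 : K) ≠ 0) : lam3 F⁻¹ = -lam3 F := by
  have hi : coeff 0 F⁻¹ ≠ 0 := by rw [coeff_zero_inv_eq]; exact inv_ne_zero hF
  have h := lam3_mul hF hi h3
  rw [PowerSeries.mul_inv_cancel F (by rwa [coeff_zero_eq_constantCoeff_apply] at hF), lam3_one] at h
  linear_combination -h

/-- The linear factor `d + X`: coefficients. -/
theorem coeff_zero_C_add_X (d : K) : coeff 0 (C d + X) = d := by simp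

/-- `coeff_one_C_add_X` (auxiliary lemma). -/
theorem coeff_one_C_add_X (d : K) : coeff 1 (C d + X) = 1 := by simp [coeff_X]

/-- `coeff_two_C_add_X` (auxiliary lemma). -/
theorem coeff_two_C_add_X (d : K) : coeff 2 (C d + X) = 0 := by simp [coeff_X]

/-- `coeff_three_C_add_X` (auxiliary lemma). -/
theorem coeff_three_C_add_X (d : K) : coeff 3 (C d + X) = 0 := by simp [coeff_X]

/-- `lam1_C_add_X` (auxiliary lemma). -/
theorem lam1_C_add_X (d : K) : lam1 (C d + X) = d⁻¹ := by
  rw [lam1, coeff_zero_C_add_X, coeff_one_C_add_X, one_div]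

/-- `lam2_C_add_X` (auxiliary lemma). -/
theorem lam2_C_add_X (d : K) : lam2 (C d + X) = -(d⁻¹) ^ 2 / 2 := by
  rw [lam2, coeff_zero_C_add_X, coeff_one_C_add_X, coeff_two_C_add_X]; ring

/-- `lam3_C_add_X` (auxiliary lemma). -/
theorem lam3_C_add_X (d : K) : lam3 (C d + X) = (d⁻¹) ^ 3 / 3 := by
  rw [lam3, coeff_zero_C_add_X, coeff_one_C_add_X, coeff_two_C_add_X, coeff_three_C_add_X]; ring

/-- Recovering the Taylor coefficients from the logarithmic ones. -/
theorem coeff_one_eq_lam (F : PowerSeries K) (hF : coeff 0 F ≠ 0) : coeff 1 F = coeff 0 F * lam1 F := by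
  unfold lam1; field_simp

/-- `coeff_two_eq_lam` (auxiliary lemma). -/
theorem coeff_two_eq_lam (F : PowerSeries K) (hF : coeff 0 F ≠ 0) (h2 : (2 : K) ≠ 0) :
    coeff 2 F = coeff 0 F * (lam2 F + lam1 F ^ 2 / 2) := by
  unfold lam1 lam2; field_simp; ring

/-- `coeff_three_eq_lam` (auxiliary lemma). -/
theorem coeff_three_eq_lam (F : PowerSeries K) (hF : coeff 0 F ≠ 0) (h2 : (2 : K) ≠ 0) (h3 : (3 : K) ≠ 0) :
    coeff 3 F = coeff 0 F * (lam3 F + lam1 F * lam2 F + lam1 F ^ 3 / 6) := by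
  unfold lam1 lam2 lam3
  rw [show (6 : K) = 2 * 3 by norm_num]
  field_simp
  ring

end LogCoeff

/-! ## §2 Power sums over the residues `y < p`, `y ≠ x` -/

section ZModSums

variable {p : ℕ} [Fact p.Prime]

/-- `Σ_{y < p, y ≠ x} ((y − x)⁻¹)^m = 0` in `ZMod p` for `1 ≤ m` and `m + 1 < p` (`= Σ_{z ∈ F_p} z^m = 0`). -/
theorem sum_range_erase_inv_sub_pow_eq_zero {x : ℕ} (hx : x < p) {m : ℕ} (hm : 1 ≤ m) (hmp : m + 1 < p) :
    ∑ y ∈ (range p).erase x, (((y : ZMod p) - (x : ZMod p))⁻¹) ^ m = 0 := by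
  rw [ResidueLaw.sum_range_erase_eq_sum_univ_erase (fun z => ((z - (x : ZMod p))⁻¹) ^ m) hx]
  have h1 : ∑ z ∈ (univ : Finset (ZMod p)).erase (x : ZMod p), ((z - (x : ZMod p))⁻¹) ^ m
      = ∑ z : ZMod p, ((z - (x : ZMod p))⁻¹) ^ m := by
    rw [← Finset.sum_erase_add _ _ (Finset.mem_univ (x : ZMod p)), sub_self, inv_zero, zero_pow (by omega), add_zero]
  have h2 := Equiv.sum_comp (Equiv.subRight (x : ZMod p)) (fun w => (w⁻¹) ^ m)
  simp only [Equiv.subRight_apply] at h2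
  have h3 := Equiv.sum_comp (Equiv.inv (ZMod p)) (fun w => w ^ m)
  simp only [Equiv.inv_apply] at h3
  have h4 := FiniteField.sum_pow_lt_card_sub_one (ZMod p) m (by rw [ZMod.card]; omega)
  rw [h1, h2, h3, h4]

end ZModSums

end Summit.KontsevichZagierPeriods.Zeta5Search.ResidueFour
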